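import Summits.RiemannHypothesis.RiemannHypothesis.Theorems.DBNFarFieldChecker
import Summits.RiemannHypothesis.RiemannHypothesis.Theorems.DBNKernelMasses
import Mathlib.Analysis.SpecialFunctions.Integrals.Basic
import Mathlib.Analysis.Complex.Basic
import HarnessLib

/-!
# RiemannHypothesis / DBN — Taylor majorants of the smeared Cauchy kernel (soundness of the T6′ checker, I)

Route `RiemannHypothesis/DBN`, column DBN (D-0040 record-keeping; cell `pub-dbn`).  Proofs only, about
the computable objects of `Theorems/DBNFarFieldChecker.lean`: evaluation lemmas of the coefficient-list
toolkit and the crude positivity bound `peval_cons_ge` behind `subCheck`; the exact complex geometric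
identity `1/(z+e) = Σ_{n<N}(-e)ⁿ/zⁿ⁺¹ + (-e)ᴺ/(zᴺ(z+e))` and the pointwise Taylor expansion
`cauchy_taylor` of `a/(a²+s²)` with exact remainder bounds; the closed-form partial biweight moments
`integral_bmoment`; and `cell_bound`: `∫_α^β φ(v) a/(a²+(ξ-κv)²) dv ≤ cellPoly(ξ-ξc) + cellRem` for
`|ξ-ξc| ≤ h`.  RH-FREE; `--supports stmt-RiemannHypothesis-0274`; nothing here bears on the truth of RH.
-/

-- D-0017: `Summit.<S>.<S>.…` is the designed namespace of a single-problem summit.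
set_option linter.dupNamespace false

namespace Summit.RiemannHypothesis.RiemannHypothesis.Theorems.DbnTheory

namespace FarField

/-! ## Part 1 — polynomial toolkit lemmas, the complex geometric identity, moments, the cell bound -/

open MeasureTheory Set intervalIntegral
open scoped Real

section PolyLemmas
variable {K : Type*} [Field K]

/-- `peval [] x = 0`. -/
@[simp] theorem peval_nil (x : K) : peval [] x = 0 := rfl

/-- `peval (a :: p) x = a + x·peval p x`. -/
@[simp] theorem peval_cons (a : K) (p : List K) (x : K) : peval (a :: p) x = a + x * peval p x := rfl

/-- `padd` is addition. -/
theorem peval_padd (p q : List K) (x : K) : peval (padd p q) x = peval p x + peval q x := by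
  induction p generalizing q with
  | nil => simp [padd]
  | cons a p ih =>
    cases q with
    | nil => simp [padd]
    | cons b q => simp only [padd, peval_cons, ih]; ring

/-- `psmul` is scalar multiplication. -/
theorem peval_psmul (c : K) (p : List K) (x : K) : peval (psmul c p) x = c * peval p x := by
  induction p with
  | nil => simp [psmul]
  | cons a p ih => simp only [psmul, peval_cons, ih]; ring

/-- `pmul` is multiplication. -/
theorem peval_pmul (p q : List K) (x : K) : peval (pmul p q) x = peval p x * peval q x := by
  induction p with
  | nil => simp [pmul]
  | cons a p ih => simp only [pmul, peval_padd, peval_psmul, peval_cons, ih]; ring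

/-- `pshift t₀ p` evaluates to `p(t₀ + x)`. -/
theorem peval_pshift (t0 : K) (p : List K) (x : K) : peval (pshift t0 p) x = peval p (t0 + x) := by
  induction p with
  | nil => simp [pshift]
  | cons a p ih => simp only [pshift, peval_padd, peval_pmul, peval_cons, peval_nil, ih]; ring

/-- `pmk f i m` evaluates to `Σ_{j<m} f(i+j) x^j`. -/
theorem peval_pmk (f : ℕ → K) (x : K) (m i : ℕ) :
    peval (pmk f i m) x = ∑ j ∈ Finset.range m, f (i + j) * x ^ j := by
  induction m generalizing i with
  | zero => simp [pmk]
  | succ m ih =>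
    rw [pmk, peval_cons, ih, Finset.sum_range_succ', Finset.mul_sum]
    simp only [add_zero, pow_zero, mul_one, pow_succ]
    rw [add_comm]
    congr 1
    refine Finset.sum_congr rfl fun j _ => ?_
    rw [show i + (j + 1) = i + 1 + j by omega]
    ring

/-- The polynomial `qOf ξc C ρ` evaluates to `4 - ((ξc+t)²+4)(C(t)+ρ)`. -/
theorem peval_qOf (xc : K) (C : List K) (ρ t : K) :
    peval (qOf xc C ρ) t = 4 - ((xc + t) ^ 2 + 4) * (peval C t + ρ) := by
  simp only [qOf, peval_padd, peval_psmul, peval_pmul, peval_cons, peval_nil]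
  ring

/-- `cellPoly` evaluates to `Σ_{n<N} tcoef n · qpoly n (t)`. -/
theorem peval_cellPoly (a κ α β xc t : K) (N : ℕ) :
    peval (cellPoly a κ α β xc N) t =
      ∑ n ∈ Finset.range N, tcoef (xc - κ * ((α + β) / 2)) a n * peval (qpoly κ α β n) t := by
  induction N with
  | zero => simp [cellPoly]
  | succ N ih => rw [cellPoly, peval_padd, peval_psmul, ih, Finset.sum_range_succ]

/-- `qpoly n` evaluates to `Σ_{j≤n} C(n,j)(-t)^j κ^{n-j} M_{n-j}`. -/
theorem peval_qpoly (κ α β t : K) (n : ℕ) :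
    peval (qpoly κ α β n) t =
      ∑ j ∈ Finset.range (n + 1), ((n.choose j : ℕ) : K) * (-t) ^ j * κ ^ (n - j) * bmoment α β (n - j) := by
  rw [qpoly, peval_pmk]
  refine Finset.sum_congr rfl fun j _ => ?_
  rw [zero_add, neg_pow t j]
  ring

end PolyLemmas

section RealPoly

/-- `pabs` is non-negative for `η ≥ 0`. -/
theorem pabs_nonneg (p : List ℝ) {η : ℝ} (hη : 0 ≤ η) : 0 ≤ pabs p η := by
  induction p with
  | nil => simp [pabs]
  | cons a p ih => simp only [pabs]; positivity

/-- `|p(x)| ≤ pabs p η` for `|x| ≤ η`. -/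
theorem abs_peval_le_pabs (p : List ℝ) {x η : ℝ} (hx : |x| ≤ η) : |peval p x| ≤ pabs p η := by
  have hη : 0 ≤ η := (abs_nonneg x).trans hx
  induction p with
  | nil => simp [pabs]
  | cons a p ih =>
    simp only [peval_cons, pabs]
    calc |a + x * peval p x| ≤ |a| + |x * peval p x| := abs_add_le _ _
      _ = |a| + |x| * |peval p x| := by rw [abs_mul]
      _ ≤ |a| + η * pabs p η := by gcongr

/-- The crude positivity bound behind `subCheck`: `d(τ) ≥ d₀ - η·pabs d' η` for `|τ| ≤ η`. -/
theorem peval_cons_ge (d0 : ℝ) (d : List ℝ) {τ η : ℝ} (hτ : |τ| ≤ η) :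
    d0 - η * pabs d η ≤ peval (d0 :: d) τ := by
  have hη : 0 ≤ η := (abs_nonneg τ).trans hτ
  rw [peval_cons]
  have h1 : |τ * peval d τ| ≤ η * pabs d η := by
    rw [abs_mul]
    exact mul_le_mul hτ (abs_peval_le_pabs d hτ) (abs_nonneg _) hη
  have h2 := neg_abs_le (τ * peval d τ)
  linarith

end RealPoly

section ComplexIdentity

/-- The exact geometric identity `1/(z+e) = Σ_{n<N} (-e)ⁿ/zⁿ⁺¹ + (-e)ᴺ/(zᴺ(z+e))`. [folklore] -/
theorem inv_add_eq_sum (z e : ℂ) (hz : z ≠ 0) (hze : z + e ≠ 0) (N : ℕ) :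
    (z + e)⁻¹ = (∑ n ∈ Finset.range N, (-e) ^ n / z ^ (n + 1)) + (-e) ^ N / (z ^ N * (z + e)) := by
  induction N with
  | zero => simp
  | succ N ih =>
    rw [Finset.sum_range_succ, ih, add_assoc]
    congr 1
    have hzN : z ^ N ≠ 0 := pow_ne_zero _ hz
    have hzN1 : z ^ (N + 1) ≠ 0 := pow_ne_zero _ hz
    field_simp
    ring

/-- `cpow s a n` is `(s + ia)^n`. -/
theorem cpow_eq_pow (s a : ℝ) (n : ℕ) :
    (⟨(cpow s a n).1, (cpow s a n).2⟩ : ℂ) = (⟨s, a⟩ : ℂ) ^ n := by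
  induction n with
  | zero => simp [cpow]; rfl
  | succ n ih =>
    rw [pow_succ, ← ih, cpow]
    apply Complex.ext <;> simp

/-- **Pointwise Taylor expansion of the Cauchy kernel with an exact remainder.**  For `a ≠ 0`:
`a/(a²+s²) = Σ_{n<2N'} (s₀-s)ⁿ·tcoef s₀ a n + R` with `|R|·|a|·(s₀²+a²)^{N'} ≤ |s-s₀|^{2N'}` and
`|R|·|s|·(s₀²+a²)^{N'} ≤ |s-s₀|^{2N'}`. [folklore] -/
theorem cauchy_taylor (a s0 s : ℝ) (ha : a ≠ 0) (N' : ℕ) :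
    ∃ R : ℝ, a / (a ^ 2 + s ^ 2) = (∑ n ∈ Finset.range (2 * N'), (s0 - s) ^ n * tcoef s0 a n) + R ∧
      |R| * |a| * (s0 ^ 2 + a ^ 2) ^ N' ≤ |s - s0| ^ (2 * N') ∧
      |R| * |s| * (s0 ^ 2 + a ^ 2) ^ N' ≤ |s - s0| ^ (2 * N') := by
  set N := 2 * N' with hN
  set z : ℂ := ⟨s0, -a⟩ with hz
  set e : ℂ := ((s - s0 : ℝ) : ℂ) with he
  have hz0 : z ≠ 0 := fun h => ha (by simpa [hz] using congrArg Complex.im h)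
  have hze : z + e = ⟨s, -a⟩ := by apply Complex.ext <;> simp [hz, he]
  have hze0 : z + e ≠ 0 := by
    rw [hze]; intro h; exact ha (by simpa using congrArg Complex.im h)
  have hid := inv_add_eq_sum z e hz0 hze0 N
  -- imaginary parts
  have him_lhs : ((z + e)⁻¹).im = a / (a ^ 2 + s ^ 2) := by
    rw [hze, Complex.inv_im]; simp [Complex.normSq_mk]; ring
  have hnormSq : Complex.normSq z = s0 ^ 2 + a ^ 2 := by simp [hz, Complex.normSq_mk]; ring
  have him_term : ∀ n : ℕ, ((-e) ^ n / z ^ (n + 1)).im = (s0 - s) ^ n * tcoef s0 a n := by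
    intro n
    have h1 : (-e) ^ n = (((s0 - s) ^ n : ℝ) : ℂ) := by rw [he]; push_cast; ring
    have h2 : (z ^ (n + 1))⁻¹ =
        (starRingEnd ℂ z) ^ (n + 1) * ((((s0 ^ 2 + a ^ 2) ^ (n + 1))⁻¹ : ℝ) : ℂ) := by
      rw [← inv_pow, Complex.inv_def, mul_pow, hnormSq, ← Complex.ofReal_pow, inv_pow]
    have hconj : starRingEnd ℂ z = ⟨s0, a⟩ := by apply Complex.ext <;> simp [hz]
    rw [div_eq_mul_inv, h1, h2, hconj, ← cpow_eq_pow, Complex.im_ofReal_mul, Complex.im_mul_ofReal, tcoef]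
    simp only
    ring
  set w : ℂ := (z ^ N * (z + e))⁻¹ with hw
  have hzpos : 0 < ‖z‖ := norm_pos_iff.mpr hz0
  have hzepos : 0 < ‖z + e‖ := norm_pos_iff.mpr hze0
  have hwle : |w.im| * (‖z‖ ^ N * ‖z + e‖) ≤ 1 := by
    have hpos : 0 < ‖z‖ ^ N * ‖z + e‖ := by positivity
    calc |w.im| * (‖z‖ ^ N * ‖z + e‖) ≤ ‖w‖ * (‖z‖ ^ N * ‖z + e‖) := by
          gcongr; exact Complex.abs_im_le_norm w
      _ = 1 := by rw [hw, norm_inv, norm_mul, norm_pow, inv_mul_cancel₀ hpos.ne']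
  have hzN : ‖z‖ ^ N = (s0 ^ 2 + a ^ 2) ^ N' := by
    rw [hN, pow_mul, Complex.sq_norm, hnormSq]
  have him_ze : (z + e).im = -a := by rw [hze]
  have hre_ze : (z + e).re = s := by rw [hze]
  have ha_le : |a| ≤ ‖z + e‖ := by
    have := Complex.abs_im_le_norm (z + e); rwa [him_ze, abs_neg] at this
  have hs_le : |s| ≤ ‖z + e‖ := by
    have := Complex.abs_re_le_norm (z + e); rwa [hre_ze] at this
  have habsR : |(s0 - s) ^ N * w.im| = |s - s0| ^ N * |w.im| := by
    rw [abs_mul, abs_pow, abs_sub_comm]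
  have hR1 : |(s0 - s) ^ N * w.im| * |a| * (s0 ^ 2 + a ^ 2) ^ N' ≤ |s - s0| ^ (2 * N') := by
    rw [habsR, ← hzN, ← hN]
    calc |s - s0| ^ N * |w.im| * |a| * ‖z‖ ^ N = |s - s0| ^ N * (|w.im| * (‖z‖ ^ N * |a|)) := by ring
      _ ≤ |s - s0| ^ N * (|w.im| * (‖z‖ ^ N * ‖z + e‖)) := by gcongr
      _ ≤ |s - s0| ^ N * 1 := by gcongr
      _ = |s - s0| ^ N := mul_one _
  have hR2 : |(s0 - s) ^ N * w.im| * |s| * (s0 ^ 2 + a ^ 2) ^ N' ≤ |s - s0| ^ (2 * N') := by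
    rw [habsR, ← hzN, ← hN]
    calc |s - s0| ^ N * |w.im| * |s| * ‖z‖ ^ N = |s - s0| ^ N * (|w.im| * (‖z‖ ^ N * |s|)) := by ring
      _ ≤ |s - s0| ^ N * (|w.im| * (‖z‖ ^ N * ‖z + e‖)) := by gcongr
      _ ≤ |s - s0| ^ N * 1 := by gcongr
      _ = |s - s0| ^ N := mul_one _
  refine ⟨(s0 - s) ^ N * w.im, ?_, ?_, ?_⟩
  · have := congrArg Complex.im hid
    rw [him_lhs, Complex.add_im, Complex.im_sum] at this
    rw [this]
    congr 1
    · exact Finset.sum_congr rfl fun n _ => him_term n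
    · have h1 : (-e) ^ N = (((s0 - s) ^ N : ℝ) : ℂ) := by rw [he]; push_cast; ring
      rw [div_eq_mul_inv, h1, Complex.im_ofReal_mul]
  · exact hR1
  · exact hR2

end ComplexIdentity

section Moments

/-- `d/dw (w^(k+1)/(k+1)) = w^k`. -/
theorem hasDerivAt_monoDiv (k : ℕ) (x : ℝ) :
    HasDerivAt (fun w : ℝ => w ^ (k + 1) / ((k : ℝ) + 1)) (x ^ k) x := by
  have h := (hasDerivAt_pow (k + 1) x).div_const ((k : ℝ) + 1)
  have hk : ((k : ℝ) + 1) ≠ 0 := by positivity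
  have heq : ((k + 1 : ℕ) : ℝ) * x ^ (k + 1 - 1) / ((k : ℝ) + 1) = x ^ k := by
    rw [Nat.add_sub_cancel]; push_cast
    rw [mul_comm, mul_div_assoc, div_self hk, mul_one]
  rw [heq] at h
  exact h

/-- The partial biweight moments in closed form:
`∫_α^β (15/16)(1-v²)²(v-v₀)^m dv = bmoment α β m`, `v₀ = (α+β)/2`. [folklore] -/
theorem integral_bmoment (α β : ℝ) (m : ℕ) :
    ∫ v in α..β, (15 / 16 : ℝ) * (1 - v ^ 2) ^ 2 * (v - (α + β) / 2) ^ m = bmoment α β m := by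
  have hderiv : ∀ v ∈ uIcc α β, HasDerivAt
      (fun v : ℝ => (15 / 16 : ℝ) * ((1 - ((α + β) / 2) ^ 2) ^ 2 * ((v - (α + β) / 2) ^ (m + 1) / ((m : ℝ) + 1))
        + (-4 * (1 - ((α + β) / 2) ^ 2) * ((α + β) / 2)) * ((v - (α + β) / 2) ^ (m + 1 + 1) / (((m + 1 : ℕ) : ℝ) + 1))
        + (4 * ((α + β) / 2) ^ 2 - 2 * (1 - ((α + β) / 2) ^ 2)) * ((v - (α + β) / 2) ^ (m + 2 + 1) / (((m + 2 : ℕ) : ℝ) + 1))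
        + (4 * ((α + β) / 2)) * ((v - (α + β) / 2) ^ (m + 3 + 1) / (((m + 3 : ℕ) : ℝ) + 1))
        + (v - (α + β) / 2) ^ (m + 4 + 1) / (((m + 4 : ℕ) : ℝ) + 1)))
      ((15 / 16 : ℝ) * (1 - v ^ 2) ^ 2 * (v - (α + β) / 2) ^ m) v := by
    intro v _
    have hw : HasDerivAt (fun v : ℝ => v - (α + β) / 2) 1 v := (hasDerivAt_id v).sub_const _
    have e0 := (hasDerivAt_monoDiv m (v - (α + β) / 2)).comp v hw
    have e1 := (hasDerivAt_monoDiv (m + 1) (v - (α + β) / 2)).comp v hw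
    have e2 := (hasDerivAt_monoDiv (m + 2) (v - (α + β) / 2)).comp v hw
    have e3 := (hasDerivAt_monoDiv (m + 3) (v - (α + β) / 2)).comp v hw
    have e4 := (hasDerivAt_monoDiv (m + 4) (v - (α + β) / 2)).comp v hw
    have hsum := ((((e0.const_mul ((1 - ((α + β) / 2) ^ 2) ^ 2)).add
      (e1.const_mul (-4 * (1 - ((α + β) / 2) ^ 2) * ((α + β) / 2)))).add
      (e2.const_mul (4 * ((α + β) / 2) ^ 2 - 2 * (1 - ((α + β) / 2) ^ 2)))).add
      (e3.const_mul (4 * ((α + β) / 2)))).add e4 |>.const_mul (15 / 16 : ℝ)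
    refine hsum.congr_deriv ?_
    ring
  have hint : IntervalIntegrable (fun v : ℝ => (15 / 16 : ℝ) * (1 - v ^ 2) ^ 2 * (v - (α + β) / 2) ^ m)
      volume α β := by
    apply Continuous.intervalIntegrable; fun_prop
  rw [integral_eq_sub_of_hasDerivAt hderiv hint]
  simp only [bmoment, monoInt]
  push_cast
  ring

/-- On `[-1,1]` the biweight is the polynomial `(15/16)(1-v²)²`. -/
theorem biweight_of_abs_le {v : ℝ} (hv : |v| ≤ 1) : biweight v = (15 / 16) * (1 - v ^ 2) ^ 2 := by
  unfold biweight; rw [if_pos hv]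

/-- Biweight moments over a cell `[α,β] ⊂ [-1,1]`. -/
theorem integral_biweight_mul_pow {α β : ℝ} (hα : -1 ≤ α) (hβ : β ≤ 1) (hαβ : α ≤ β) (k : ℕ) :
    ∫ v in α..β, biweight v * (v - (α + β) / 2) ^ k = bmoment α β k := by
  rw [← integral_bmoment]
  refine intervalIntegral.integral_congr fun v hv => ?_
  rw [uIcc_of_le hαβ] at hv
  have : |v| ≤ 1 := abs_le.mpr ⟨by linarith [hv.1], by linarith [hv.2]⟩
  simp only [biweight_of_abs_le this]

/-- `∫_α^β φ(v)(x + κ(v-v₀))ⁿ dv = Σ_j C(n,j) x^j κ^{n-j} M_{n-j}`. -/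
theorem integral_biweight_mul_add_pow {α β : ℝ} (hα : -1 ≤ α) (hβ : β ≤ 1) (hαβ : α ≤ β)
    (x κ : ℝ) (n : ℕ) :
    ∫ v in α..β, biweight v * (x + κ * (v - (α + β) / 2)) ^ n =
      ∑ j ∈ Finset.range (n + 1), ((n.choose j : ℕ) : ℝ) * x ^ j * κ ^ (n - j) * bmoment α β (n - j) := by
  have hfun : (fun v => biweight v * (x + κ * (v - (α + β) / 2)) ^ n) = fun v =>
      ∑ j ∈ Finset.range (n + 1), (((n.choose j : ℕ) : ℝ) * x ^ j * κ ^ (n - j)) *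
        (biweight v * (v - (α + β) / 2) ^ (n - j)) := by
    funext v
    rw [add_pow, Finset.mul_sum]
    refine Finset.sum_congr rfl fun j _ => ?_
    rw [mul_pow]; ring
  rw [hfun, intervalIntegral.integral_finsetSum]
  · refine Finset.sum_congr rfl fun j _ => ?_
    rw [intervalIntegral.integral_const_mul, integral_biweight_mul_pow hα hβ hαβ]
  · intro j _
    apply Continuous.intervalIntegrable
    exact continuous_const.mul (continuous_biweight.mul (by fun_prop))

end Moments

section Cell

/-- **Cell bound.**  For `a > 0`, `κ ≥ 0`, a cell `[α,β] ⊂ [-1,1]` and `|ξ - ξc| ≤ h`: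
`∫_α^β φ(v)·a/(a²+(ξ-κv)²) dv ≤ cellPoly(ξ - ξc) + cellRem` (Taylor polynomial of order `2N'` from the
exact complex geometric identity, remainder bounded by `(h+κr)^{2N'}/((s₀²+a²)^{N'} a)·M₀`). -/
theorem cell_bound {a κ α β xc h ξ : ℝ} (ha : 0 < a) (hκ : 0 ≤ κ) (hαβ : α ≤ β) (hα : -1 ≤ α)
    (hβ : β ≤ 1) (N' : ℕ) (ht : |ξ - xc| ≤ h) :
    ∫ v in α..β, biweight v * (a / (a ^ 2 + (ξ - 0 - κ * v) ^ 2)) ≤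
      peval (cellPoly a κ α β xc (2 * N')) (ξ - xc) + cellRem a κ α β xc h N' := by
  have hv0r : ∀ v ∈ Icc α β, |v - (α + β) / 2| ≤ (β - α) / 2 := fun v hv =>
    abs_le.mpr ⟨by linarith [hv.1], by linarith [hv.2]⟩
  set s0 := xc - κ * ((α + β) / 2) with hs0
  set E := h + κ * ((β - α) / 2) with hE
  set D := (s0 ^ 2 + a ^ 2) ^ N' with hD
  have hDpos : 0 < D := by positivity
  have hh : 0 ≤ h := (abs_nonneg _).trans ht
  have hr0 : 0 ≤ (β - α) / 2 := by linarith
  have hE0 : 0 ≤ E := by positivity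
  -- pointwise majorant
  have hpt : ∀ v ∈ Icc α β, biweight v * (a / (a ^ 2 + (ξ - 0 - κ * v) ^ 2)) ≤
      biweight v * (∑ n ∈ Finset.range (2 * N'), (s0 - (ξ - 0 - κ * v)) ^ n * tcoef s0 a n)
        + biweight v * (E ^ (2 * N') / (D * a)) := by
    intro v hv
    obtain ⟨R, hR, hR1, -⟩ := cauchy_taylor a s0 (ξ - 0 - κ * v) ha.ne' N'
    rw [hR, mul_add]
    have hbw := biweight_nonneg v
    have hes : |ξ - 0 - κ * v - s0| ≤ E := by
      have : ξ - 0 - κ * v - s0 = (ξ - xc) - κ * (v - (α + β) / 2) := by rw [hs0]; ring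
      rw [this]
      calc |(ξ - xc) - κ * (v - (α + β) / 2)| ≤ |ξ - xc| + |κ * (v - (α + β) / 2)| := abs_sub _ _
        _ = |ξ - xc| + κ * |v - (α + β) / 2| := by rw [abs_mul, abs_of_nonneg hκ]
        _ ≤ h + κ * ((β - α) / 2) := by gcongr; exact hv0r v hv
    have hpow : |ξ - 0 - κ * v - s0| ^ (2 * N') ≤ E ^ (2 * N') :=
      pow_le_pow_left₀ (abs_nonneg _) hes _
    rw [abs_of_pos ha] at hR1
    have h4 : R * (D * a) ≤ |R| * a * D := by
      have := mul_le_mul_of_nonneg_right (le_abs_self R) (mul_pos hDpos ha).le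
      linarith [this]
    have h3 : R ≤ E ^ (2 * N') / (D * a) := by
      rw [le_div_iff₀ (by positivity)]
      linarith
    gcongr
  -- integrate the majorant
  have hint_l : IntervalIntegrable (fun v => biweight v * (a / (a ^ 2 + (ξ - 0 - κ * v) ^ 2)))
      volume α β := by
    apply Continuous.intervalIntegrable
    exact continuous_biweight.mul (continuous_const.div (by fun_prop) (fun v => by positivity))
  have hcont1 : Continuous (fun v => biweight v *
      (∑ n ∈ Finset.range (2 * N'), (s0 - (ξ - 0 - κ * v)) ^ n * tcoef s0 a n)) :=
    continuous_biweight.mul (continuous_finsetSum _ fun n _ => by fun_prop)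
  have hcont2 : Continuous (fun v => biweight v * (E ^ (2 * N') / (D * a))) :=
    continuous_biweight.mul continuous_const
  have hint_r : IntervalIntegrable (fun v => biweight v *
      (∑ n ∈ Finset.range (2 * N'), (s0 - (ξ - 0 - κ * v)) ^ n * tcoef s0 a n)
        + biweight v * (E ^ (2 * N') / (D * a))) volume α β :=
    (hcont1.add hcont2).intervalIntegrable _ _
  have hmono := intervalIntegral.integral_mono_on hαβ hint_l hint_r (fun v hv => hpt v hv)
  refine hmono.trans (le_of_eq ?_)
  rw [intervalIntegral.integral_add (hcont1.intervalIntegrable _ _) (hcont2.intervalIntegrable _ _)]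
  congr 1
  · -- main part = peval cellPoly
    have hfun : (fun v => biweight v *
        (∑ n ∈ Finset.range (2 * N'), (s0 - (ξ - 0 - κ * v)) ^ n * tcoef s0 a n)) = fun v =>
        ∑ n ∈ Finset.range (2 * N'), tcoef s0 a n *
          (biweight v * (-(ξ - xc) + κ * (v - (α + β) / 2)) ^ n) := by
      funext v
      rw [Finset.mul_sum]
      refine Finset.sum_congr rfl fun n _ => ?_
      have : s0 - (ξ - 0 - κ * v) = -(ξ - xc) + κ * (v - (α + β) / 2) := by rw [hs0]; ring
      rw [this]; ring
    rw [hfun, intervalIntegral.integral_finsetSum, peval_cellPoly]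
    · refine Finset.sum_congr rfl fun n _ => ?_
      rw [intervalIntegral.integral_const_mul, integral_biweight_mul_add_pow hα hβ hαβ, peval_qpoly]
    · intro n _
      exact (continuous_const.mul (continuous_biweight.mul (by fun_prop))).intervalIntegrable _ _
  · -- remainder part = cellRem
    rw [intervalIntegral.integral_mul_const]
    have h0 := integral_biweight_mul_pow hα hβ hαβ 0
    simp only [pow_zero, mul_one] at h0
    rw [h0, cellRem]
    ring

end Cell

end FarField

end Summit.RiemannHypothesis.RiemannHypothesis.Theorems.DbnTheory
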